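import Literature.Computability.AlgebraicComplexity.TauConjectureProofs
import Literature.Computability.Complexity.CHIterProd
import Literature.Computability.Complexity.CHIterProdBits
import HarnessLib

/-!
# Bürgisser's Corollary 3.8: factorials are definable in the counting hierarchy

Companion file of `Literature.Computability.AlgebraicComplexity.TauConjectureProofs` for the named
fact `Burgisser2009_factorial_chDefinable` (P. Bürgisser, ECCC TR06-113, Cor. 3.8: "The sequence of
factorials `(n!)` is definable in `CH`. More generally, the falling factorials
`(n(n-1)⋯(n-k+1))_{k ≤ n}` are definable in `CH`." Proof: "This follows from Theorem 3.7 and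
Remark 3.2."), assembled in the scaled-up `FOM + MAJ` calculus of
`Literature/Computability/Complexity/CH*.lean`:

* the factor families `i ↦ (i < n ? i + 1 : 1)` and `i ↦ (i < k ? n - i : 1)` are polynomial-time
  (Remark 3.2), so their graphs and bit predicates are in `CH`
  (`facFactorGraph_mem_CH`, `descFactorGraph_mem_CH`);
* `n! = ∏_{i < 2^{|bin n|}} (i < n ? i + 1 : 1)` and
  `n(n-1)⋯(n-k+1) = ∏_{i < 2^{|⟨bin n, bin k⟩|}} (i < k ? n - i : 1)` (`factorial_eq_prod_range_ite`,
  `descFactorial_eq_prod_range_ite`);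
* the assembly `Burgisser2009_factorial_chDefinable_of_iterProd`: Cor. 3.8 follows from the
  bit-predicate form of Thm. 3.7(1) for products (iterated multiplication in `CH`), with the
  sign languages trivial (all values are `≥ 0`) and the bit-size bounds `n! ≤ 2^{n²}`,
  `n(n-1)⋯(n-k+1) ≤ 2^{n²}` (`k ≤ n`, `n > 1`).

## References

* P. Bürgisser, *On defining integers in the counting hierarchy and proving lower bounds in
  algebraic complexity*, ECCC TR06-113 (2006), Def. 3.1, Rem. 3.2, Thm. 3.7, Cor. 3.8; journal
  version Comput. Complexity 18 (2009) 81–103.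
* W. Hesse, E. Allender, D. A. M. Barrington, JCSS 65 (2002) 695–716, §4.
-/

noncomputable section

open Polynomial Finset
open Literature.Computability.Complexity Computability

namespace Literature.Computability.AlgebraicComplexity

open PRelSigma TTClosure Brick PPSharpP ThresholdPP Plumb

/-! ### Factorials and falling factorials as padded products -/

/-- `n! = ∏_{i < N} (i < n ? i + 1 : 1)` for `N ≥ n` (padding the product with ones). [folklore] -/
theorem factorial_eq_prod_range_ite {n N : ℕ} (h : n ≤ N) :
    n.factorial = ∏ i ∈ range N, (if i < n then i + 1 else 1) := by
  rw [← prod_range_add_one_eq_factorial, ← prod_range_mul_prod_Ico _ h]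
  have h2 : ∏ i ∈ Ico n N, (if i < n then i + 1 else 1) = 1 :=
    prod_eq_one fun i hi => by rw [if_neg (by have := (mem_Ico.1 hi).1; omega)]
  rw [h2, mul_one]
  exact prod_congr rfl fun i hi => by rw [if_pos (mem_range.1 hi)]

/-- `n(n-1)⋯(n-k+1) = ∏_{i < N} (i < k ? n - i : 1)` for `N ≥ k`. [folklore] -/
theorem descFactorial_eq_prod_range_ite (n : ℕ) {k N : ℕ} (h : k ≤ N) :
    n.descFactorial k = ∏ i ∈ range N, (if i < k then n - i else 1) := by
  rw [Nat.descFactorial_eq_prod_range, ← prod_range_mul_prod_Ico _ h]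
  have h2 : ∏ i ∈ Ico k N, (if i < k then n - i else 1) = 1 :=
    prod_eq_one fun i hi => by rw [if_neg (by have := (mem_Ico.1 hi).1; omega)]
  rw [h2, mul_one]
  exact prod_congr rfl fun i hi => by rw [if_pos (mem_range.1 hi)]

/-! ### The factor families are polynomial-time -/

/-- The graph of the constant function `1` is in `CH`. [folklore] -/
theorem constOneGraph_mem_CH : {z | (fun _ : List Bool => (1 : ℕ)) (fstP z) = bitsToNat (sndP z)} ∈ CH :=
  mem_CH_of_iff (P_subset_CH (preimage_mem_P (valEqConst_mem_P 1) sndP_mem_FP)) _ fun z => by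
    change (1 : ℕ) = bitsToNat (sndP z) ↔ bitsToNat (sndP z) = 1
    exact eq_comm

/-- **The factor family of `n!`** on `w = ⟨bin n, bin i⟩`: `i < n ? i + 1 : 1`; its graph is in
`CH` (indeed in `P`: Bürgisser 2006, Remark 3.2). [cite: Burgisser2006, Remark 3.2] -/
theorem facFactorGraph_mem_CH :
    {z | (if bitsToNat (sndP (fstP z)) < bitsToNat (fstP (fstP z)) then bitsToNat (sndP (fstP z)) + 1 else 1) =
      bitsToNat (sndP z)} ∈ CH := by
  have hQ : ({w | bitsToNat (sndP w) < bitsToNat (fstP w)} : Language Bool) ∈ CH := P_subset_CH gtVal_mem_P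
  have hf : {z | (fun w => bitsToNat (sndP w) + 1) (fstP z) = bitsToNat (sndP z)} ∈ CH :=
    mem_CH_of_iff (P_subset_CH (preimage_mem_P addGraph_mem_P
      (pairFn_mem_FP (pairFn_mem_FP (comp_mem_FP sndP_mem_FP fstP_mem_FP) (const_mem_FP (encodeNat 1))) sndP_mem_FP))) _
      fun z => by
        change bitsToNat (sndP (fstP z)) + 1 = bitsToNat (sndP z) ↔
          bitsToNat (fstP (fstP (pairFn (pairFn (sndP ∘ fstP) (fun _ => encodeNat 1)) sndP z))) +
            bitsToNat (sndP (fstP (pairFn (pairFn (sndP ∘ fstP) (fun _ => encodeNat 1)) sndP z))) =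
          bitsToNat (sndP (pairFn (pairFn (sndP ∘ fstP) (fun _ => encodeNat 1)) sndP z))
        simp only [pairFn_apply, Function.comp_apply, fstP_boolPair, sndP_boolPair, bitsToNat_encodeNat]
  exact iteGraph_mem_CH' (Q := fun w => bitsToNat (sndP w) < bitsToNat (fstP w)) hQ
    (f := fun w => bitsToNat (sndP w) + 1) (g := fun _ => 1) hf constOneGraph_mem_CH

/-- Bit-size of the factorial factors: `< 2^{|w| + 1}`. [folklore] -/
theorem facFactor_lt_two_pow (w : List Bool) :
    (if bitsToNat (sndP w) < bitsToNat (fstP w) then bitsToNat (sndP w) + 1 else 1) < 2 ^ (X + 1 : Polynomial ℕ).eval w.length := by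
  rw [eval_add, eval_X, eval_one, pow_succ]
  have h1 : bitsToNat (sndP w) < 2 ^ w.length :=
    (bitsToNat_lt _).trans_le (Nat.pow_le_pow_right (by norm_num)
      ((Nat.le_add_left _ _).trans (bitPowModSum_lt_two_pow.length_components_le' w)))
  have h2 : 1 ≤ 2 ^ w.length := Nat.one_le_two_pow
  split_ifs <;> omega

/-- The factorial factors on an index word: `⟨bin n, bin i⟩ ↦ (i < n ? i + 1 : 1)`. [folklore] -/
theorem facFactor_apply (u : List Bool) (i : ℕ) :
    (if bitsToNat (sndP (boolPair u (encodeNat i))) < bitsToNat (fstP (boolPair u (encodeNat i)))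
      then bitsToNat (sndP (boolPair u (encodeNat i))) + 1 else 1) = if i < bitsToNat u then i + 1 else 1 := by
  simp only [fstP_boolPair, sndP_boolPair, bitsToNat_encodeNat]

/-- **The factor family of the falling factorial** on `w = ⟨⟨bin n, bin k⟩, bin i⟩`:
`i < k ? n - i : 1`; its graph is in `CH` (indeed in `P`, Bürgisser 2006, Remark 3.2). [cite: Burgisser2006, Remark 3.2] -/
theorem descFactorGraph_mem_CH :
    {z | (if bitsToNat (sndP (fstP z)) < bitsToNat (sndP (fstP (fstP z)))
          then bitsToNat (fstP (fstP (fstP z))) - bitsToNat (sndP (fstP z)) else 1) = bitsToNat (sndP z)} ∈ CH := by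
  have hQ : ({w | bitsToNat (sndP w) < bitsToNat (sndP (fstP w))} : Language Bool) ∈ CH :=
    P_subset_CH (mem_P_of_iff (preimage_mem_P ltVal_mem_P (pairFn_mem_FP sndP_mem_FP (comp_mem_FP sndP_mem_FP fstP_mem_FP))) _
      fun w => by
        change _ ↔ bitsToNat (fstP (pairFn sndP (sndP ∘ fstP) w)) < bitsToNat (sndP (pairFn sndP (sndP ∘ fstP) w))
        rw [pairFn_apply, fstP_boolPair, sndP_boolPair]; rfl)
  have hf : {z | (fun w => bitsToNat (fstP (fstP w)) - bitsToNat (sndP w)) (fstP z) = bitsToNat (sndP z)} ∈ CH :=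
    mem_CH_of_iff (P_subset_CH (preimage_mem_P subGraph_mem_P
      (pairFn_mem_FP (pairFn_mem_FP (comp_mem_FP fstP_mem_FP (comp_mem_FP fstP_mem_FP fstP_mem_FP)) (comp_mem_FP sndP_mem_FP fstP_mem_FP))
        sndP_mem_FP))) _
      fun z => by
        change bitsToNat (fstP (fstP (fstP z))) - bitsToNat (sndP (fstP z)) = bitsToNat (sndP z) ↔
          bitsToNat (fstP (fstP (pairFn (pairFn (fstP ∘ fstP ∘ fstP) (sndP ∘ fstP)) sndP z))) -
            bitsToNat (sndP (fstP (pairFn (pairFn (fstP ∘ fstP ∘ fstP) (sndP ∘ fstP)) sndP z))) =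
          bitsToNat (sndP (pairFn (pairFn (fstP ∘ fstP ∘ fstP) (sndP ∘ fstP)) sndP z))
        simp only [pairFn_apply, Function.comp_apply, fstP_boolPair, sndP_boolPair]
  exact iteGraph_mem_CH' (Q := fun w => bitsToNat (sndP w) < bitsToNat (sndP (fstP w))) hQ
    (f := fun w => bitsToNat (fstP (fstP w)) - bitsToNat (sndP w)) (g := fun _ => 1) hf constOneGraph_mem_CH

/-- Bit-size of the falling-factorial factors: `< 2^{|w| + 1}`. [folklore] -/
theorem descFactor_lt_two_pow (w : List Bool) :
    (if bitsToNat (sndP w) < bitsToNat (sndP (fstP w)) then bitsToNat (fstP (fstP w)) - bitsToNat (sndP w) else 1) <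
      2 ^ (X + 1 : Polynomial ℕ).eval w.length := by
  rw [eval_add, eval_X, eval_one, pow_succ]
  have h1 : bitsToNat (fstP (fstP w)) < 2 ^ w.length :=
    (bitsToNat_lt _).trans_le (Nat.pow_le_pow_right (by norm_num) ((length_fstP_le _).trans (length_fstP_le w)))
  have h2 : 1 ≤ 2 ^ w.length := Nat.one_le_two_pow
  split_ifs <;> omega

/-- The falling-factorial factors on an index word: `⟨⟨bin n, bin k⟩, bin i⟩ ↦ (i < k ? n - i : 1)`. [folklore] -/
theorem descFactor_apply (u : List Bool) (i : ℕ) :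
    (if bitsToNat (sndP (boolPair u (encodeNat i))) < bitsToNat (sndP (fstP (boolPair u (encodeNat i))))
      then bitsToNat (fstP (fstP (boolPair u (encodeNat i)))) - bitsToNat (sndP (boolPair u (encodeNat i))) else 1) =
      if i < bitsToNat (sndP u) then bitsToNat (fstP u) - i else 1 := by
  simp only [fstP_boolPair, sndP_boolPair, bitsToNat_encodeNat]

/-! ### Bit-size bounds -/

/-- `n! ≤ 2^{n²}`. [folklore] -/
theorem factorial_le_two_pow_sq (n : ℕ) : n.factorial ≤ 2 ^ (n ^ 2) :=
  calc n.factorial ≤ n ^ n := Nat.factorial_le_pow n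
    _ ≤ (2 ^ n) ^ n := Nat.pow_le_pow_left Nat.lt_two_pow_self.le n
    _ = 2 ^ (n ^ 2) := by rw [← pow_mul, sq]

/-- `n(n-1)⋯(n-k+1) ≤ 2^{n²}` for `k ≤ n` (Bürgisser 2006, §3: "note that `a(n, k) ≤ 2^{n²}`"). [cite: Burgisser2006, §3] -/
theorem descFactorial_le_two_pow_sq {n k : ℕ} (hk : k ≤ n) : n.descFactorial k ≤ 2 ^ (n ^ 2) :=
  calc n.descFactorial k ≤ n ^ k := Nat.descFactorial_le_pow n k
    _ ≤ (2 ^ n) ^ k := Nat.pow_le_pow_left Nat.lt_two_pow_self.le k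
    _ ≤ (2 ^ n) ^ n := Nat.pow_le_pow_right (Nat.one_le_two_pow) hk
    _ = 2 ^ (n ^ 2) := by rw [← pow_mul, sq]

/-! ### Bit languages from bit predicates -/

/-- Turning a bit predicate `{⟨x, j⟩ | bit (val j) of a x is 1} ∈ CH` into the bit language of
Def. 3.1, `{⟨x, ⟨j, b⟩⟩ | bit (val j) of a x equals b}` (`b` read off the head of the last
component). [cite: Burgisser2006, Def. 3.1] -/
theorem bitLang_mem_CH {a : List Bool → ℕ} (ha : {z | (a (fstP z)).testBit (bitsToNat (sndP z)) = true} ∈ CH) :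
    ({w | (a (fstP w)).testBit (bitsToNat (fstP (sndP w))) = true ↔ sndP (sndP w) ∈ HeadIs true} : Language Bool) ∈ CH := by
  have hT : (pairFn fstP (fstP ∘ sndP) ⁻¹' {z | (a (fstP z)).testBit (bitsToNat (sndP z)) = true}) ∈ CH :=
    preimage_mem_CH ha (pairFn_mem_FP fstP_mem_FP (comp_mem_FP fstP_mem_FP sndP_mem_FP))
  have hH : ((sndP ∘ sndP) ⁻¹' HeadIs true) ∈ Classes.P := preimage_mem_P (HeadIs_mem_P true) (comp_mem_FP sndP_mem_FP sndP_mem_FP)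
  refine mem_CH_of_iff (union_mem_CH (inter_mem_CH hT (P_subset_CH hH))
    (inter_mem_CH (compl_mem_CH hT) (compl_mem_CH (P_subset_CH hH)))) _ fun w => ?_
  rw [memL_sup, memL_inf', memL_inf', memL_compl, memL_compl]
  change ((a (fstP w)).testBit (bitsToNat (fstP (sndP w))) = true ↔ sndP (sndP w) ∈ HeadIs true) ↔
    ((a (fstP (pairFn fstP (fstP ∘ sndP) w))).testBit (bitsToNat (sndP (pairFn fstP (fstP ∘ sndP) w))) = true ∧
        (sndP ∘ sndP) w ∈ HeadIs true) ∨
      (¬ (a (fstP (pairFn fstP (fstP ∘ sndP) w))).testBit (bitsToNat (sndP (pairFn fstP (fstP ∘ sndP) w))) = true ∧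
        ¬ (sndP ∘ sndP) w ∈ HeadIs true)
  simp only [pairFn_apply, Function.comp_apply, fstP_boolPair, sndP_boolPair]
  tauto

/-- Reading the bit language at a query `⟨x, ⟨bin j, [b]⟩⟩`. [cite: Burgisser2006, Def. 3.1] -/
theorem mem_bitLang_iff (a : List Bool → ℕ) (x : List Bool) (j : ℕ) (b : Bool) :
    boolPair x (boolPair (encodeNat j) [b]) ∈
        ({w | (a (fstP w)).testBit (bitsToNat (fstP (sndP w))) = true ↔ sndP (sndP w) ∈ HeadIs true} : Language Bool) ↔
      (a x).testBit j = b := by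
  change ((a (fstP (boolPair x (boolPair (encodeNat j) [b])))).testBit
      (bitsToNat (fstP (sndP (boolPair x (boolPair (encodeNat j) [b]))))) = true ↔
        sndP (sndP (boolPair x (boolPair (encodeNat j) [b]))) ∈ HeadIs true) ↔ _
  simp only [fstP_boolPair, sndP_boolPair, bitsToNat_encodeNat, mem_HeadIs, List.head?_cons, Option.some.injEq]
  cases (a x).testBit j <;> cases b <;> simp

/-! ### Assembly: Cor. 3.8 from iterated multiplication in `CH` -/

/-- **Bürgisser's Corollary 3.8, core assembly**: if the bits of `n!` (read off `⟨bin n, bin j⟩`)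
and of `n(n-1)⋯(n-k+1)` (read off `⟨⟨bin n, bin k⟩, bin j⟩`), written as the padded products of
their factor families, form `CH` languages, then `Burgisser2009_factorial_chDefinable` holds: the
sign languages are trivial (all values are `≥ 0`, Def. 3.1), the bit-size bounds are `n! ≤ 2^{n²}`
and `n(n-1)⋯(n-k+1) ≤ 2^{n²}` (§3), and `q(n) = n` is polynomially bounded. [cite: Burgisser2006, Cor. 3.8] -/
theorem Burgisser2009_factorial_chDefinable_of_iterProd'
    (hFac : {z | (∏ i ∈ range (2 ^ (X : Polynomial ℕ).eval (fstP z).length),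
        (if bitsToNat (sndP (boolPair (fstP z) (encodeNat i))) < bitsToNat (fstP (boolPair (fstP z) (encodeNat i)))
          then bitsToNat (sndP (boolPair (fstP z) (encodeNat i))) + 1 else 1)).testBit (bitsToNat (sndP z)) = true} ∈ CH)
    (hDesc : {z | (∏ i ∈ range (2 ^ (X : Polynomial ℕ).eval (fstP z).length),
        (if bitsToNat (sndP (boolPair (fstP z) (encodeNat i))) < bitsToNat (sndP (fstP (boolPair (fstP z) (encodeNat i))))
          then bitsToNat (fstP (fstP (boolPair (fstP z) (encodeNat i)))) - bitsToNat (sndP (boolPair (fstP z) (encodeNat i)))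
          else 1)).testBit (bitsToNat (sndP z)) = true} ∈ CH) :
    Burgisser2009_factorial_chDefinable := by
  -- bits of `n!` and of `n(n-1)⋯(n-k+1)`
  have hFac' : {z | ((bitsToNat (fstP z)).factorial).testBit (bitsToNat (sndP z)) = true} ∈ CH := by
    refine mem_CH_of_iff hFac _ fun z => ?_
    change ((bitsToNat (fstP z)).factorial).testBit (bitsToNat (sndP z)) = true ↔
      Nat.testBit (∏ i ∈ range (2 ^ (X : Polynomial ℕ).eval (fstP z).length),
        (if bitsToNat (sndP (boolPair (fstP z) (encodeNat i))) < bitsToNat (fstP (boolPair (fstP z) (encodeNat i)))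
          then bitsToNat (sndP (boolPair (fstP z) (encodeNat i))) + 1 else 1)) (bitsToNat (sndP z)) = true
    simp only [facFactor_apply, eval_X]
    rw [← factorial_eq_prod_range_ite (bitsToNat_lt (fstP z)).le]
  have hDesc' : {z | ((bitsToNat (fstP (fstP z))).descFactorial (bitsToNat (sndP (fstP z)))).testBit (bitsToNat (sndP z)) =
      true} ∈ CH := by
    refine mem_CH_of_iff hDesc _ fun z => ?_
    change ((bitsToNat (fstP (fstP z))).descFactorial (bitsToNat (sndP (fstP z)))).testBit (bitsToNat (sndP z)) = true ↔
      Nat.testBit (∏ i ∈ range (2 ^ (X : Polynomial ℕ).eval (fstP z).length),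
        (if bitsToNat (sndP (boolPair (fstP z) (encodeNat i))) < bitsToNat (sndP (fstP (boolPair (fstP z) (encodeNat i))))
          then bitsToNat (fstP (fstP (boolPair (fstP z) (encodeNat i)))) - bitsToNat (sndP (boolPair (fstP z) (encodeNat i)))
          else 1)) (bitsToNat (sndP z)) = true
    simp only [descFactor_apply, eval_X]
    rw [← descFactorial_eq_prod_range_ite _ ((bitsToNat_lt (sndP (fstP z))).le.trans
      (Nat.pow_le_pow_right (by norm_num)
        ((Nat.le_add_left _ _).trans (bitPowModSum_lt_two_pow.length_components_le' (fstP z)))))]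
  unfold Burgisser2009_factorial_chDefinable IsCHDefinable₁ IsCHDefinable IsDefinableIn₁ IsDefinableIn HasPolyBitsize
  refine ⟨⟨⟨2, fun n _ => ?_⟩, ⟨⊤, P_subset_CH top_mem_P, fun n => ?_⟩,
    ⟨_, bitLang_mem_CH (a := fun x => (bitsToNat x).factorial) hFac', fun n j b => ?_⟩⟩, ⟨?_, ⟨2, fun n k _ hk => ?_⟩,
    ⟨⊤, P_subset_CH top_mem_P, fun n k _ => ?_⟩,
    ⟨_, bitLang_mem_CH (a := fun x => (bitsToNat (fstP x)).descFactorial (bitsToNat (sndP x))) hDesc', fun n k j b _ => ?_⟩⟩⟩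
  · dsimp only
    rw [abs_of_nonneg (by positivity)]
    exact_mod_cast factorial_le_two_pow_sq n
  · exact ⟨fun _ => by positivity, fun _ => trivial⟩
  · refine (mem_bitLang_iff (fun x => (bitsToNat x).factorial) (encodeNat n) j b).trans ?_
    simp only [bitsToNat_encodeNat, Int.natAbs_natCast]
  · exact IsPBounded.id
  · dsimp only
    rw [abs_of_nonneg (by positivity)]
    exact_mod_cast descFactorial_le_two_pow_sq hk
  · exact ⟨fun _ => by positivity, fun _ => trivial⟩
  · refine (mem_bitLang_iff (fun x => (bitsToNat (fstP x)).descFactorial (bitsToNat (sndP x)))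
      (boolPair (encodeNat n) (encodeNat k)) j b).trans ?_
    simp only [fstP_boolPair, sndP_boolPair, bitsToNat_encodeNat, Int.natAbs_natCast]

/-- **Bürgisser's Corollary 3.8 from Theorem 3.7** (iterated multiplication in `CH`, bit-predicate
form: if the bits of a family `G ⟨u, bin i⟩` of numbers form a `CH` language then so do the bits
of `∏_{i < 2^{p|u|}} G ⟨u, bin i⟩`): the factorials `(n!)` and the falling factorials
`(n(n-1)⋯(n-k+1))_{k ≤ n}` are definable in `CH` ("This follows from Theorem 3.7 and
Remark 3.2"). [cite: Burgisser2006, Cor. 3.8] -/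
theorem Burgisser2009_factorial_chDefinable_of_iterProd
    (hIMS : ∀ (G : List Bool → ℕ) (p : Polynomial ℕ),
      {z | (G (fstP z)).testBit (bitsToNat (sndP z)) = true} ∈ CH →
      {z | (∏ i ∈ range (2 ^ p.eval (fstP z).length), G (boolPair (fstP z) (encodeNat i))).testBit
        (bitsToNat (sndP z)) = true} ∈ CH) :
    Burgisser2009_factorial_chDefinable :=
  Burgisser2009_factorial_chDefinable_of_iterProd'
    (hIMS (fun w => if bitsToNat (sndP w) < bitsToNat (fstP w) then bitsToNat (sndP w) + 1 else 1) X
      (testBitGraph_mem_CH (f := fun w => if bitsToNat (sndP w) < bitsToNat (fstP w) then bitsToNat (sndP w) + 1 else 1)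
        (p := X + 1) facFactorGraph_mem_CH facFactor_lt_two_pow))
    (hIMS (fun w => if bitsToNat (sndP w) < bitsToNat (sndP (fstP w))
        then bitsToNat (fstP (fstP w)) - bitsToNat (sndP w) else 1) X
      (testBitGraph_mem_CH (f := fun w => if bitsToNat (sndP w) < bitsToNat (sndP (fstP w))
        then bitsToNat (fstP (fstP w)) - bitsToNat (sndP w) else 1) (p := X + 1) descFactorGraph_mem_CH descFactor_lt_two_pow))

/-- The factor families are (very) short: `G u < 2^{|u|+1} ≤ 2^{2^{|u|+1}}`. [folklore] -/
theorem lt_two_pow_two_pow_of_lt {G : List Bool → ℕ} (hG : ∀ u, G u < 2 ^ (X + 1 : Polynomial ℕ).eval u.length) (u : List Bool) :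
    G u < 2 ^ 2 ^ (X + 1 : Polynomial ℕ).eval u.length :=
  (hG u).trans_le (Nat.pow_le_pow_right (by norm_num) Nat.lt_two_pow_self.le)

/-- **Bürgisser's Corollary 3.8 from Theorem 3.7, bit-predicate form with a size bound**: the same
assembly when the iterated-multiplication theorem carries the hypothesis `G u < 2^{2^{r|u|}}`
(doubly exponential size bound on the factors, as in `CHModArith.bitPowModSum_mod_eq`). [cite: Burgisser2006, Cor. 3.8] -/
theorem Burgisser2009_factorial_chDefinable_of_iterProdBounded
    (hIMS : ∀ (G : List Bool → ℕ) (p r : Polynomial ℕ),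
      {z | (G (fstP z)).testBit (bitsToNat (sndP z)) = true} ∈ CH → (∀ u, G u < 2 ^ 2 ^ r.eval u.length) →
      {z | (∏ i ∈ range (2 ^ p.eval (fstP z).length), G (boolPair (fstP z) (encodeNat i))).testBit
        (bitsToNat (sndP z)) = true} ∈ CH) :
    Burgisser2009_factorial_chDefinable :=
  Burgisser2009_factorial_chDefinable_of_iterProd'
    (hIMS (fun w => if bitsToNat (sndP w) < bitsToNat (fstP w) then bitsToNat (sndP w) + 1 else 1) X (X + 1)
      (testBitGraph_mem_CH (f := fun w => if bitsToNat (sndP w) < bitsToNat (fstP w) then bitsToNat (sndP w) + 1 else 1)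
        (p := X + 1) facFactorGraph_mem_CH facFactor_lt_two_pow) (lt_two_pow_two_pow_of_lt facFactor_lt_two_pow))
    (hIMS (fun w => if bitsToNat (sndP w) < bitsToNat (sndP (fstP w))
        then bitsToNat (fstP (fstP w)) - bitsToNat (sndP w) else 1) X (X + 1)
      (testBitGraph_mem_CH (f := fun w => if bitsToNat (sndP w) < bitsToNat (sndP (fstP w))
        then bitsToNat (fstP (fstP w)) - bitsToNat (sndP w) else 1) (p := X + 1) descFactorGraph_mem_CH descFactor_lt_two_pow)
      (lt_two_pow_two_pow_of_lt descFactor_lt_two_pow))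

/-- **Bürgisser's Corollary 3.8 from Theorem 3.7, graph form**: the same assembly from the
iterated-multiplication theorem stated for families of SHORT numbers given by a `CH` graph
(`{⟨w, ν⟩ | a w = val ν} ∈ CH`, `a w < 2^{q|w|}`) — the factor families of `n!` and of
`n(n-1)⋯(n-k+1)` are of this kind (`facFactorGraph_mem_CH`, `descFactorGraph_mem_CH`). [cite: Burgisser2006, Cor. 3.8] -/
theorem Burgisser2009_factorial_chDefinable_of_iterProdGraph
    (hIMS : ∀ (a : List Bool → ℕ) (q p : Polynomial ℕ),
      {z | a (fstP z) = bitsToNat (sndP z)} ∈ CH → (∀ w, a w < 2 ^ q.eval w.length) →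
      {z | (∏ i ∈ range (2 ^ p.eval (fstP z).length), a (boolPair (fstP z) (encodeNat i))).testBit
        (bitsToNat (sndP z)) = true} ∈ CH) :
    Burgisser2009_factorial_chDefinable :=
  Burgisser2009_factorial_chDefinable_of_iterProd'
    (hIMS (fun w => if bitsToNat (sndP w) < bitsToNat (fstP w) then bitsToNat (sndP w) + 1 else 1) (X + 1) X
      facFactorGraph_mem_CH facFactor_lt_two_pow)
    (hIMS (fun w => if bitsToNat (sndP w) < bitsToNat (sndP (fstP w))
        then bitsToNat (fstP (fstP w)) - bitsToNat (sndP w) else 1) (X + 1) X descFactorGraph_mem_CH descFactor_lt_two_pow)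

/-- **Bürgisser's Corollary 3.8** (discharge of the named fact
`Burgisser2009_factorial_chDefinable`): "The sequence of factorials `(n!)` is definable in `CH`.
More generally, the falling factorials `(n(n-1)⋯(n-k+1))_{k ≤ n}` are definable in `CH`." —
"This follows from Theorem 3.7 and Remark 3.2." (ECCC TR06-113, p. 12). Here: the assembly
`Burgisser2009_factorial_chDefinable_of_iterProdBounded` (Rem. 3.2 for the factor families, the
product representations of `n!` and `n(n-1)⋯(n-k+1)`) fed with the bit-predicate form of
Thm. 3.7(1), `Literature.Computability.Complexity.iterProdBits_mem_CH` (iterated multiplication in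
`CH`). [cite: Burgisser2006, Cor. 3.8] -/
theorem Burgisser2009_factorial_chDefinable_holds : Burgisser2009_factorial_chDefinable :=
  Burgisser2009_factorial_chDefinable_of_iterProdBounded fun _ p r hG hGb =>
    iterProdBits_mem_CH p r hG hGb

end Literature.Computability.AlgebraicComplexity
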